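import Mathlib
import HarnessLib
import HarnessLib.Audit
import Summits.CriticalPhenomena.Statement
import Literature.Probability.RandomPlanarGeometry.HexSAW
import HarnessLib.Audit.Status.Attr

/-!
Route: SAWMassiveIsingTilt

DORMANT since 2026-08-26T09:39:29Z (reconciler: no traction for 8.4 d (last activity item-evidence-added at 2026-08-18T00:10:33Z); parked, not closed — `ledger route dormant route-CriticalPhenomena-SAWMassiveIsingTilt --off` to reactiva) — unstaffed, not closed; items shared with open routes are served there. `ledger route dormant <id> --off` reactivates.

# Route SAWMassiveIsingTilt — Pay the line, cool the sea — the hexagonal SAW is the y = 0 end of the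
length-tilted massive Ising interface; SLE(8/3) by an infrared limit at the solved Ising corner,
restriction produced by mass

It suffices to show X = (C) ∧ (U), realising idea card pay-the-line-cool-the-sea (instance I,
hexagonal lattice / Ising corner).
Fix the two-parameter TILTED INTERFACE LAWS 𝔓_{x,y} on self-avoiding walks γ : a_δ → b_δ of Ω_δ ⊆
δHex: 𝔓_{x,y}(γ) ∝ x^{ℓ(γ)} · Zloop(Ω_δ ∖ γ; y),
Zloop(H, S; y) = Σ over even subgraphs E of H[S] of y^{|E|} (the loop O(1) gas = low-temperature
Ising contours on the faces = high-temperature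
Ising graphs on the vertices; y_c = 1/√3). The edge y = 0 is EXACTLY the hexagonal SAW law at
fugacity x (Zloop ≡ 1); the diagonal x = y is the
Ising Dobrushin interface. (C) OneClassOnCriticalCurve — Conjecture C of the card with the SAW
corner pinned: there is a critical tilt x_c(y) with
x_c(0) = 1/√(2+√2) such that for EVERY 0 ≤ y < y_c, every Dobrushin domain and hexagonal endpoint
approximation, 𝔓_{x_c(y),y} → chordal SLE_{8/3}
(so κ = 8/3 fills the open critical curve; κ = 3 only at its massless end (y_c, y_c)). (U)
LatticeUniversality — the shared Hex → ℤ² transfer crux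
(stmt-CriticalPhenomena-0807). The route reaches (C) crux-first through the solved corner:
MassiveWindowSLE (cool the critical Ising interface by a
vanishing amount y = y_c − m(δ)δ, m → ∞, and pay the line: some tilt x(δ) gives SLE_{8/3}) and
CriticalCurveContinuity (no transition along the
open curve: MassiveWindowSLE → C); RestrictionFromMass is the engine (a massive bath forgets the
room beyond its correlation length) typed on the lattice.
Lean: `(let Zloop : SimpleGraph Literature.Probability.LatticeModels.HexVertex → Set
Literature.Probability.LatticeModels.HexVertex → ℝ → ℝ := fun H S y => ∑ᶠ E ∈ {E : Finset (Sym2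
Literature.Probability.LatticeModels.HexVertex) | (∀ e ∈ E, e ∈ H.edgeSet ∧ ∀ v ∈ e, v ∈ S) ∧ ∀ v :
Literature.Probability.LatticeModels.HexVertex, Even (E.filter (fun e => v ∈ e)).card}, y ^ E.card;
let tilt : (Ω : Set ℂ) → (δ : ℝ) → ℝ → ℝ → (a b : Literature.Probability.LatticeModels.HexVertex) →
MeasureTheory.Measure (Literature.Probability.RandomPlanarGeometry.SAW.HexDomainSAW Ω δ a b) := fun
Ω δ x y a b => MeasureTheory.Measure.sum (fun γ :
Literature.Probability.RandomPlanarGeometry.SAW.HexDomainSAW Ω δ a b => ENNReal.ofReal (x ^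
γ.vertexCount * Zloop (Literature.Probability.RandomPlanarGeometry.SAW.hexDomainGraph Ω δ) {v | v ∉
γ.walk.support} y) • MeasureTheory.Measure.dirac γ); let tiltLaw : (Ω : Set ℂ) → (δ : ℝ) → ℝ → ℝ →
(a b : Literature.Probability.LatticeModels.HexVertex) → MeasureTheory.Measure
(Literature.Probability.RandomPlanarGeometry.SAW.HexDomainSAW Ω δ a b) := fun Ω δ x y a b => (tilt Ω
δ x y a b Set.univ)⁻¹ • tilt Ω δ x y a b; ∃ xc : ℝ → ℝ, xc 0 =
Literature.Probability.RandomPlanarGeometry.SAW.hexCriticalFugacity ∧ ∀ y ∈ Set.Ico (0 : ℝ)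
(Real.sqrt 3)⁻¹, ∀ (D : Literature.Probability.RandomPlanarGeometry.DobrushinDomain) (a b : ℝ →
Literature.Probability.LatticeModels.HexVertex),
Literature.Probability.RandomPlanarGeometry.SAW.IsEmbEndpointApprox
Literature.Probability.LatticeModels.hexGraph Literature.Probability.LatticeModels.hexCenter D a b →
Literature.Probability.RandomPlanarGeometry.ConvergesInLawToSLE ((8 : NNReal) / 3) D (fun δ (γ :
Literature.Probability.RandomPlanarGeometry.SAW.HexDomainSAW D.carrier δ (a δ) (b δ)) => γ.curve)
(fun δ => tiltLaw D.carrier δ (xc y) y (a δ) (b δ))) ∧ (∀ (D :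
Literature.Probability.RandomPlanarGeometry.DobrushinDomain) (a b : ℝ →
Literature.Probability.LatticeModels.Site 2) (a' b' : ℝ →
Literature.Probability.LatticeModels.HexVertex),
Literature.Probability.RandomPlanarGeometry.SAW.IsEndpointApprox D a b →
Literature.Probability.RandomPlanarGeometry.SAW.IsEmbEndpointApprox
Literature.Probability.LatticeModels.hexGraph Literature.Probability.LatticeModels.hexCenter D a' b'
→ ∀ f : BoundedContinuousFunction (Literature.Probability.RandomPlanarGeometry.CurveClass ℂ) ℝ,
Filter.Tendsto (fun δ => (∫ γ, f γ.curve ∂(Literature.Probability.RandomPlanarGeometry.SAW.law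
D.carrier δ (a δ) (b δ))) - ∫ γ, f γ.curve
∂(Literature.Probability.RandomPlanarGeometry.SAW.hexSAWLaw D.carrier δ (a' δ) (b' δ))) (nhdsWithin
0 (Set.Ioi 0)) (nhds 0))`

## Assembly
Deciding theorem `closes` (rev 1; sorry-free, pure logic, unchanged): MassiveWindowSLE and
CriticalCurveContinuity (= MassiveWindowSLE → OneClassOnCriticalCurve)
give the target OneClassOnCriticalCurve; CornerLaw identifies the y = 0 edge of the tilted family
with the hexagonal SAW law EXACTLY
(tiltLaw Ω δ x_c(Hex) 0 a b = hexSAWLaw Ω δ a b — an equality of measures, no named conjecture);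
HexEndpointApproxExists gives every δℤ² endpoint
approximation a hexagonal companion; CornerTransfer (CornerLaw → HexEndpointApproxExists →
OneClassOnCriticalCurve → LatticeUniversality → SAWScalingLimit,
PROVED) transfers to δℤ². closes : MassiveWindowSLE → CriticalCurveContinuity → CornerLaw →
HexEndpointApproxExists → CornerTransfer → LatticeUniversality → SAWScalingLimit.
The Assembly ITEM (rev 4, 2026-08-16) is the content-bearing form of the same chain WITHOUT the
pure-glue support CornerTransfer among its antecedents:
Assembly : MassiveWindowSLE → CriticalCurveContinuity → CornerLaw → HexEndpointApproxExists →
LatticeUniversality → SAWScalingLimit — it carries the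
corner transfer itself (specialise the target at y = 0, rewrite xc 0 = hexCriticalFugacity and
CornerLaw, pick a hexagonal endpoint approximation,
Tendsto.add with the LatticeUniversality difference) and is provable now in three lines over the
landed CornerTransfer_proof; rev 2's Assembly
(stmt-CriticalPhenomena-10351, = the type of `closes` verbatim) was pure propositional logic over
the two implication items and failed the ground
battery (ground.trivial: intros; aesop). RestrictionFromMass is the engine of MassiveWindowSLE's
layer-2 proof and is not a hypothesis of either.
Repair 2026-08-15 (rev 2): rev 0's CornerIdentity (OneClassOnCriticalCurve → HexSAWScalingLimit) and
the shared HexToSquare (HexSAWScalingLimit →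
LatticeUniversality → SAWScalingLimit) were dropped from this route because they named DCS
Conjecture 1 (a registered OPEN conjecture) and kept the
route unstaffable; the Hex payoff OneClassOnCriticalCurve ⇒ HexSAWScalingLimit remains a ten-line
corollary of CornerLaw.

Rationale: WHY THIS LINE. Every lattice statement is an identity: 𝔓_{x,y} = (x/y)^{ℓ} × (Ising interface law at
contour fugacity y), and 𝔓_{x,0} is `hexSAWLaw` verbatim, so the
SAW sits at the corner of a square whose diagonal end (y_c, y_c) is the best-understood interface in
the field (critical Ising → SLE₃, CDHKSCRAS2014,
ChelkakSmirnov2012Ising; massive/near-critical fermions ChelkakIzyurovMahfouf2023, Park2022; massive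
SLEs MakarovSmirnov2010, arXiv:2606.13147).
The identification of SLE_{8/3} uses no SAW observable and no exponent: two-sided restriction is
PRODUCED by the mass (exponential decoupling of a
subcritical bath, the engine of Ornstein–Zernike theory, CampaninoIoffeVelenik2003,
GreenbergIoffe2005) and conformal covariance is CARRIED by the
solved Ising field theory, so LawlerSchrammWerner2003Restriction closes once the infrared limit
exists; the untilted massive interface is diffusive and
the over-tilted one dense (DuminilCopinKozmaYadin2014), so exactly one critical curve is used.
Imported areas: near-critical/massive planar Ising
(fermionic observables, massive SLE), cluster expansion and high-temperature mixing
(KoteckyPreiss1986, AizenmanBarskyFernandezJSP1987), conformal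
restriction. Unlike route SAWLoopFugacityFlow (deforms the loop weight n and leaves solvability) the
bulk stays free-fermion at every (x, y); unlike
SAWEdwardsStrongCoupling (IR limit from a Brownian anchor, barrier PlanarEdwardsModelDiffusive) the
UV object is already simple and fractal; the
negatives index (stmt-0772, all-δ tightness) is avoided: every item converges or is tight only along
𝓝[>]0.

RANKED CRUXES. #0 OneClassOnCriticalCurve (target) — Conjecture C with the SAW corner pinned (the
new half of X; the other half is the shared crux LatticeUniversality): there is xc : ℝ → ℝ with xc 0
= hexCriticalFugacity = 1/√(2+√2) such that for every y ∈ [0, 1/√3), every Dobrushin domain D and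
hexagonal endpoint approximation, the tilted interface law 𝔓_{xc(y), y} (weight
x^{ℓ(γ)}·Zloop(Ω_δ∖γ; y), normalised) pushed to CurveClass ℂ converges in law to chordal SLE_{8/3}
in D (ConvergesInLawToSLE (8/3)). At y = 0 this is DCS Conjecture 1 (HexSAWScalingLimit) verbatim.
(why it might fail: an intermediate multicritical point on the curve (bath-mediated depletion
attraction of range ξ(y) collapsing the walk before y_c), or x_c(y) first-order for y > 0; and it
contains DCS Conjecture 1 at y = 0.) [DuminilCopinSmirnov2012, Nienhuis1982, DuplantierSaleur1987,
LawlerSchrammWerner2004SAW, Literature.Probability.RandomPlanarGeometry.SAW.HexSAWScalingLimit]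
#2 MassiveWindowSLE (crux) — COOL AND PAY ⇒ 8/3 (card N1+N2+N3, diagonalised into one lattice
statement; hardest and most informative): there are m, x : ℝ → ℝ with m(δ) → +∞ and m(δ)·δ → 0 as δ
→ 0+ (so y(δ) := 1/√3 − m(δ)δ ↑ y_c: the Ising bath is cooled by a macroscopically vanishing but
microscopically diverging amount, correlation length 1/m(δ) → 0 in the domain and → ∞ in lattice
units) such that for every Dobrushin domain and hexagonal endpoint approximation the tilted Ising
interface laws 𝔓_{x(δ), y(δ)} converge in law on CurveClass ℂ to chordal SLE_{8/3}. Informally: the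
infrared limit of the near-critical family Q_{m,s} (massive SLE₃ ⊗ e^{s𝔏}, 𝔏 the 11/8-dimensional
natural length) along its critical tilt s_c(m) is conformally invariant (covariance + profile
insensitivity), satisfies two-sided restriction (from mass) on simple curves, hence is SLE_{8/3} by
LSW03 — read back on the lattice along a diagonal. [deps: RestrictionFromMass] [difficulty:
open-problem] (why it might fail: no convergence theorem for thermal near-critical Ising interfaces
(massive SLE₃ conjectural); the massless drained bath leaves a ONE-sided restriction-1/2 path
(Werner–Wu), so mass+tilt must move the exponent to 5/8; the diagonal limit may not exist or may
remember the mass profile.) [MakarovSmirnov2010, WernerWu2013, doi:10.1214/ejp.v18-2376,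
LawlerSchrammWerner2003Restriction, ChelkakIzyurovMahfouf2023, Park2022,
doi:10.1007/s00220-022-04488-6, arXiv:2606.13147, CDHKSCRAS2014, GreenbergIoffe2005,
doi:10.1016/j.anihpb.2005.05.001, CamiaJiangNewman2020]
#3 CriticalCurveContinuity (crux) — NO TRANSITION ON THE OPEN CRITICAL CURVE (card N4):
MassiveWindowSLE → OneClassOnCriticalCurve — the SLE_{8/3} limit obtained along one cooled-and-paid
path entering the Ising corner propagates to every fixed 0 ≤ y < y_c along the critical curve x_c(y)
and in particular to the SAW corner (x_c(0), 0) = (1/√(2+√2), 0): the scaling limit of 𝔓_{x_c(y),y}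
is constant in y (score decoupling Cov_y(f(γ), ∂_y log Zloop(Ω_δ∖γ; y)) → 0: the y-score is a
fugacity renormalisation plus an irrelevant finite-range remainder), the double limit (δ → 0, y ↑
y_c) commuting with y ↓ 0. [deps: MassiveWindowSLE, RestrictionFromMass] [difficulty: XL] (why it
might fail: the bubble-mediated self-interaction is a depletion ATTRACTION of range ξ(y) ↑ ∞; a
θ-like multicritical y_θ < y_c (cf. Duplantier–Saleur: a CRITICAL annealed bath on Hex gives κ = 6
at (x,y) = (1,1)) or an x-first-order stretch would break constancy on [0, y_c).)
[DuplantierSaleur1987, doi:10.1103/PhysRevLett.59.539, DuminilCopinKozmaYadin2014, arXiv:0908.0452,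
BloteNienhuis1989, Nienhuis1982, DuminilCopinSmirnov2012]
#4 LatticeUniversality (crux) — the shared Hex → ℤ² transfer (item stmt-CriticalPhenomena-0807 of
routes SAWHexUniversality / SAWResidueField, re-wanted verbatim): for every Dobrushin domain,
square-lattice endpoint approximation (a_δ, b_δ) and hexagonal one (a′_δ, b′_δ) and every bounded
continuous f on CurveClass ℂ, ∫ f∘curve dP^{ℤ²}_{x_c(ℤ²),δ} − ∫ f∘curve dP^{Hex}_{x_c(Hex),δ} → 0 as
δ → 0+. [difficulty: open-problem] (why it might fail: uniform ℤ² SAW is in no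
Yang–Baxter/integrable family (GlazmanManolescu2019 p.1; barrier NienhuisWeightsExcludeVertexSAW):
no transfer tool reaches it; lattice effects persist in limits of boundary SAW ensembles
(KennedyLawler2013); the typed difference → 0 needs tightness of both.) [GlazmanManolescu2019,
arXiv:1109.3091, DuminilCopinSmirnov2012,
Literature.Barriers.CriticalPhenomena.NienhuisWeightsExcludeVertexSAW,
Literature.Barriers.CriticalPhenomena.not_hasExactVertexRelationZ2]
#5 RestrictionFromMass (crux) — RESTRICTION EMERGES FROM MASS, on the lattice (card N2(b), the
engine of MassiveWindowSLE): for every 0 ≤ y < 1/√3 there are C and c > 0 such that for every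
Dobrushin domain D, mesh δ > 0, vertex set S ⊆ V := vertices of Ω_δ (H := hexDomainGraph D.carrier
δ) and hexagonal SAW γ of Ω_δ with vertices T ⊆ S: |log( Zloop(H, V∖T; y)·Zloop(H, S; y) / (Zloop(H,
S∖T; y)·Zloop(H, V; y)) )| ≤ C Σ_{v ∈ γ} Σ_{w ∈ V∖S} exp(−c·d_Hex(v, w)). In words: the
Radon–Nikodym defect between 𝔓_{x,y} in Ω conditioned on γ ⊂ S and 𝔓_{x,y} in the subdomain S is
exp(O(Σ e^{−c·dist})): a massive bath forgets the room beyond its correlation length, so two-sided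
conformal restriction holds asymptotically at every y < y_c and exactly in the infrared limit. Route
to a proof: Zloop(H[S]; y) is the high-temperature expansion of the Ising model on the subgraph H[S]
at tanh β = y < tanh β_c(Hex) = 1/√3; small y by Kotecký–Preiss (polymers = cycles), all y < y_c by
Griffiths monotonicity in the subgraph + ABF sharpness + integration of edge-energy differences
along an interpolation of the couplings on E(V)∖E(S). [difficulty: L] (why it might fail: constants
must be uniform over ALL slit subgraphs S ⊆ Ω_δ and blow up as y ↑ y_c; only y inside the
Kotecký–Preiss radius (cycles at activity y^|loop|, μ_Hex·y small) is routine — the full range needs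
ratio mixing of HT Ising on arbitrary subgraphs in free-energy-difference form.) [KoteckyPreiss1986,
AizenmanBarskyFernandezJSP1987, FriedliVelenik2017, CampaninoIoffeVelenik2003,
GriffithsHurstSherman1970, LawlerSchrammWerner2003Restriction]
#9 CornerLaw (support, stmt-CriticalPhenomena-9857) — the y = 0 edge of the tilted family IS the
hexagonal SAW law: for every Ω, δ, a, b, tiltLaw Ω δ x_c(Hex) 0 a b = hexSAWLaw Ω δ a b — Zloop(H,
S; 0) = 1 (only E = ∅ survives: finsum_eq_single), so the tilted weight is x_c^{ℓ(γ)} and the tilted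
law is embLaw at hexCriticalFugacity = hexSAWLaw, definitionally (proof sketch = refuter evidence on
the retired stmt-CriticalPhenomena-7688). [difficulty: provable-now] [DuminilCopinSmirnov2012]
#9 HexEndpointApproxExists (support, stmt-CriticalPhenomena-9864) — every Dobrushin domain with a
δℤ² endpoint approximation admits a hexagonal one (bulk component of the hexagonal mesh graph
accumulates at every boundary point). [difficulty: M] [DuminilCopinSmirnov2012 §4;
LawlerSchrammWerner2004SAW §3.4]
#9 CornerTransfer (support, stmt-CriticalPhenomena-9865) — CornerLaw → HexEndpointApproxExists →
OneClassOnCriticalCurve → LatticeUniversality → SAWScalingLimit: specialise the target at y = 0,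
rewrite xc 0 = hexCriticalFugacity and CornerLaw, pick a hexagonal endpoint approximation, add the
LatticeUniversality difference on bounded continuous test functions (Tendsto.add), pack
ConvergesInLawToSLE. [difficulty: provable-now] [DuminilCopinSmirnov2012, GlazmanManolescu2019]
#1 Assembly (assembly) — MassiveWindowSLE → CriticalCurveContinuity → CornerLaw →
HexEndpointApproxExists → LatticeUniversality → SAWScalingLimit: the content-bearing assembly (the
corner transfer carried inside, CornerTransfer NOT an antecedent); provable now: `intro hMW hCC hCL
hHE hLU; exact CornerTransfer_proof hCL hHE (hCC hMW) hLU` over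
Theorems/SAWMassiveIsingTiltCornerTransfer.lean. [difficulty: provable-now]
(Repair 2026-08-15, rev 1–2: deciding theorem closes : MassiveWindowSLE → CriticalCurveContinuity →
CornerLaw → HexEndpointApproxExists → CornerTransfer → LatticeUniversality → SAWScalingLimit filed;
rev 0's CornerIdentity (stmt-7688) and the shared HexToSquare (stmt-5428) dropped from this route —
they named the registered open conjecture HexSAWScalingLimit and made the dependency cone
unstaffable; Assembly restated to the closes chain (stmt-10351). Repair 2026-08-16, rev 4 (ground):
stmt-10351 = the type of `closes` verbatim was pure propositional logic over the implication items
CriticalCurveContinuity / CornerTransfer and failed the #h21_ground battery (ground.trivial: intros;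
aesop); restated 1:1 to the 5-antecedent content-bearing form above (battery re-run locally: no
flag); `closes` unchanged. The rev-2 proof file Theorems/SAWMassiveIsingTiltAssembly.lean
(massiveIsingTilt_assembly_proof) no longer matches the decl and is superseded by the three-line
proof over CornerTransfer_proof.)

TWO-LAYER PLAN. Foreseen glued splits (k ≤ 3, depth 1), nothing filed now. MassiveWindowSLE ⇐
WindowFamilyLimit (for fixed m, s the window laws
𝔓_{y(1+sδ^{11/8}), y_c−mδ} converge, jointly with δ^{11/8}ℓ(γ), to a continuum law Q_{m,s}:
Ising-side RSW/Kemppainen–Smirnov tightness + massive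
fermion identification) → InfraredLimit (∃ s_c(m): Q_{m,s_c(m)} → chordal SLE_{8/3} as m → ∞, by
exact covariance m ↦ m|ψ′|, s ↦ s|ψ′|^{11/8},
the continuum form of RestrictionFromMass, simplicity, and LSW03) → (diagonal-extraction glue) →
MassiveWindowSLE. CriticalCurveContinuity ⇐
TiltedEventualTightness (of 𝔓_{x_c(y),y}, uniform on compacts of [0, y_c)) → ScoreDecoupling
(Cov_y(f(γ), ∂_y log-weight) → 0 along the curve)
→ CriticalCurveContinuity. RestrictionFromMass ⇐ SmallFugacity (Kotecký–Preiss regime) → FullRange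
(HT-Ising ratio mixing on subgraphs).
LatticeUniversality: decomposed in route SAWHexUniversality (Yang–Baxter family), not here.

KILL CRITERIA. ¬MassiveWindowSLE (every cooled-and-paid diagonal limit fails to be SLE_{8/3}: e.g. a
proof that tilted near-critical Ising interfaces stay
one-sided-restriction/SLE₃-like at all scales, or that the tilt transition in the window is first
order) closes the route `refuted:MassiveWindowSLE`.
An exhibited multicritical point y_θ < y_c (numerics then proof) refutes CriticalCurveContinuity and
closes the route (no second solvable anchor on
[0, y_θ)). ¬RestrictionFromMass at some y < y_c would contradict high-temperature Ising mixing —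
treat as a misstatement (restate), not a kill.
¬LatticeUniversality removes the ℤ² conclusion for this and three sibling routes; the Hex half
(OneClassOnCriticalCurve ⇒ HexSAWScalingLimit) stays
valuable. HexSAWScalingLimit proved elsewhere supersedes K1–K2; SAWScalingLimit proved elsewhere
moots everything.

NOT DECOMPOSED YET. The continuum objects (massive SLE₃, the natural length 𝔏, the family Q_{m,s}
and its critical tilt s_c(m)) are deliberately NOT posited as Lean
objects at open: MassiveWindowSLE is lattice-anchored and ∃-quantifies the tilt; the predicted
window scaling x/y − 1 ≍ s·δ^{11/8} and
y_c − y ≍ m·δ (thermal eigenvalue 1) live in the Numbers. The bulk definition of x_c(y)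
(half-plane/bridge growth rate of tilted weights) is
replaced by ∃ xc in the target. Eventual tightness of 𝔓_{x,y} (from the Ising side inside the
window; from routes SAWRenewalTightness /
SAWLeftRightFKG only at y = 0). Instance (II) of the card (ℤ²-native monomer–dimer square,
Heilmann–Lieb corner x = λ, double-dimer corner
λ = ∞) is a separate route if MassiveWindowSLE moves. x_c(y) > y (the untilted massive interface is
a subcritical polymer, Greenberg–Ioffe OZ)
is used only heuristically.

CHEAPEST FALSIFIER. Transfer matrices (kit, exact sparse, widths L ≤ 12) for the honeycomb loop gas
with loop-edge weight y and ONE open strand of edge weight x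
crossing a cylinder: at y = 0.3 and 0.45 (ξ(y) a few lattice units ≪ L) locate x_c(y, L) from the
closing of the strand free-energy gap and read the
one-leg dimension X₁ from its 2πX₁/L² amplitude: the line predicts X₁ = 5/48 ≈ 0.104 (dilute O(0), g
= 3/2) for every y < y_c, against 1/8 (Ising
spin, g = 4/3) at y = y_c and θ′/dense values beyond; X₁ drifting with y at fixed large L, or a
first-order jump of the strand density at x_c(y),
kills OneClassOnCriticalCurve cheaply. Cheaper still for the engine: exact enumeration of the
restriction defect of RestrictionFromMass on hexagonal
boxes of ≤ 40 vertices at y = 0.3 versus dist(γ, V∖S) — it must decay exponentially. Not run in this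
planning seat (no kit in plancard mode).

NUMBERS. x_c(Hex) = 1/√(2+√2) = 0.5412 (DuminilCopinSmirnov2012 Thm 1); y_c = x_c(n=1) =
1/√(2+√(2−1)) = 1/√3 = 0.5774 = tanh β_c(honeycomb Ising)
(Nienhuis1982). Corners of the square: (x_c, 0) SAW, κ = 8/3, d = 4/3, two-sided restriction
exponent 5/8 (LawlerSchrammWerner2003Restriction,
LawlerSchrammWerner2004SAW); (y_c, y_c) critical Ising interface, κ = 3, d = 11/8, c = 1/2,
Werner–Wu one-sided exponent (6−κ)/2κ = 1/2;
(1, 1) percolation exploration / Duplantier–Saleur θ′ point, κ = 6, ν_θ = 4/7 (the whole line y = 1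
is the vacancy-mediated ISAW:
Zloop(H∖γ; 1) = 2^{dim cycle space of H∖γ}). Window: y_c − y = mδ (ν_Ising = 1), tilt x/y − 1 ≍
sδ^{11/8}; one-leg dimensions X₁ = gL²/8 −
(g−1)²/2g at L = 1: 5/48 (g = 3/2, SAW) vs 1/8 (g = 4/3, Ising). Kotecký–Preiss regime for cycles on
Hex (μ_Hex = 1.8478): roughly y ≲ 0.2.
Items at open: 8 (1 target, 4 cruxes, 2 support, 1 assembly); after the 2026-08-15 repair: 9 (1
target, 4 cruxes, 3 support, 1 assembly), unchanged by the 2026-08-16 restate of the assembly —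
LatticeUniversality shared with existing routes; CornerLaw and CornerTransfer proved.

DEFINITION REQUESTS. None blocking: Zloop and the tilted law are inlined `let`s over hexDomainGraph
/ HexDomainSAW / embMeshDomain (HexSAW.lean). Optional, to shorten
signatures and serve the layer-2 children: `hexLoopGasPartition (H : SimpleGraph HexVertex) (S : Set
HexVertex) (y : ℝ) : ℝ` and
`tiltedInterfaceLaw Ω δ x y a b : Measure (HexDomainSAW Ω δ a b)` in
Literature/Probability/LatticeModels (finite sums, no existence smuggled),
with the lemmas `hexLoopGasPartition_zero : … 0 = 1` and `tiltedInterfaceLaw_zero :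
tiltedInterfaceLaw Ω δ x 0 a b = embLaw hexGraph hexCenter Ω δ x a b`.
Bib: GreenbergIoffe2005 (doi:10.1016/j.anihpb.2005.05.001), DuplantierSaleur1987
(doi:10.1103/PhysRevLett.59.539), WernerWu2013
(doi:10.1214/ejp.v18-2376), Park2022 (doi:10.1007/s00220-022-04488-6) prepared in
folder/bib/all4.bib (gate bib add timed out at filing).

Novelty: Searches (2026-08-15): `lit frontier CriticalPhenomena --since 2020` (30 rows; arXiv:2310.17299
sub-ballisticity the only SAW item; nothing on tilted or massive interfaces); `lit bridges
CriticalPhenomena --cross any` (30 rows, none relevant); `lit search --hybrid "Ising interface low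
temperature length-biased self-avoiding walk scaling limit massive loop O(n) model honeycomb"` (15
book hits, generic: MadrasSlade1993, Yeomans); `lit vsearch "<thesis in prose>"` (8, generic
textbooks); zbMATH: "massive SLE Ising interface near-critical" (1: arXiv:2606.13147), "off-critical
lattice models massive SLEs" (MakarovSmirnov2010), "massive Ising fermionic observables Park"
(Park2022 = arXiv:2103.04649), "universality spin correlations Ising isoradial"
(ChelkakIzyurovMahfouf2023), "near-critical Ising interface" (5: arXiv:2606.13147, arXiv:2104.06660,
Park2022, arXiv:2512.10142), "Ising interface Ornstein-Zernike" (4: arXiv:0908.0452,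
arXiv:2001.04737, Hryniv–Kotecký 2002), "massive loop-erased random walk SLE" (4: arXiv:2203.15717,
arXiv:1309.6068), "from CLE to SLE Werner Wu" (arXiv:1210.3264), "self-avoiding walk Ising bath" (1,
irrelevant), five longer queries (annealed SAW–Ising, length-fugacity interface, honeycomb vacancies
θ point, depletion bath, Dobrushin interface scaling) 0 hits; crossref "length-biased Ising
interface self-avoiding walk" (8: Ising-on-SAW-chain papers, irrelevant); `lit galaxy search --star
all` "massive SLE" (3), "near-critical Ising" (7), "polymer in an I  [refs: 2310.17299, 2606.13147, 2103.04649, 2104.06660, 2512.10142, 0908.0452, 2001.04737, 2203.15717, 1309.6068, 1210.3264, MadrasSlade1993, MakarovSmirnov2010, Park2022, ChelkakIzyurovMahfouf2023]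

Barriers (technique_class: massive-bulk length-tilt, IR-limit, restriction-from-mass): - technique_class: massive-bulk length-tilt, IR-limit, restriction-from-mass
- Literature.Barriers.CriticalPhenomena.NienhuisWeightsExcludeVertexSAW: evaded by design — no
vertex relation or discrete-holomorphic observable is written for any SAW; the free fermion is used
only for the Ising bath (exact at every y) and the uniform ℤ² walk enters solely through the shared
transfer crux LatticeUniversality (where the barrier is conceded, as in SAWHexUniversality).
- Literature.Barriers.CriticalPhenomena.ParafermionicHalfCauchyRiemann: not met — the SAW
parafermion (DCS Lemma 1) is never used; HexSAWScalingLimit is reached from the Ising corner by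
MassiveWindowSLE + CriticalCurveContinuity, not from the observable.
- Literature.Barriers.CriticalPhenomena.PlanarEdwardsModelDiffusive: mirrored, not violated — the
UNtilted massive interface is diffusive (Greenberg–Ioffe OZ) exactly as bounded self-repulsion of
Brownian motion is; criticality is restored by the length reward x ↑ x_c(y), and the tilted object
is a lattice interface / SLE₃-class curve, never Wiener measure, so absolute continuity w.r.t. BM is
not in play.
- Literature.Barriers.CriticalPhenomena.SupercriticalSAWSpaceFilling: respected — every statement is
pinned to the critical curve (∃ x_c(y), with x_c(0) = 1/μ(Hex) exactly); x > x_c(y) dense and x <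
x_c(y) ballistic are used as the reason the curve exists, and no item is open in x.
- Literature.Barriers.CriticalPhenomena.SAWNoUnitaryCFT: not met — the flow runs from th

Novelty grade: new-combination — ROUTE REVIEW (refuter rreview a895813f, 2026-08-15). Grade inherited from the card's novelty audit (new-combination: (x,y) square at n=1 with both edges exact, 8/3 on the open critical curve, entry via the near-critical Ising window, restriction produced by mass — parts known: Werner–Wu, OZ, LSW03;  (refuter refuter-rreview-route-ValiantsHypothesis-a895813f-0, 2026-08-15T14:07:46Z; prior: arXiv:1210.3264 Werner–Wu 2013 Thm 1 (massless corner: one-sided restriction-1/2 path + CLE_3 loops), MakarovSmirnov2010 (massive SLEs); arXiv:2606.13147; Park2022 doi:10.1007/s00220-022-04488-6; ChelkakIzyurovMahfouf2023 (near-critical/massive Ising), doi:10.1016/j.anihpb.2005.05.001 Greenberg–Ioffe 2005; CampaninoIoffeVelenik2003 (OZ: massive interfaces diffusive), doi:10.1103/PhysRevLett.59.539)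

History (route lifecycle, newest last):
- 2026-08-15T16:12:00Z · rev 2: restated Assembly (stmt-CriticalPhenomena-7689) — route-repair (cone): re-route around the registered OPEN CONJECTURE Literature.Probability.RandomPlanarGeometry.SAW.HexSAWScalingLimit (DCS Conj. 1, [status: op (planner-rbadge-CriticalPhenomena-SAWMassiveIsi-b208270b-g4-0)
- 2026-08-15T16:12:00Z · rev 2: dropped CornerIdentity, HexToSquare — route-repair (cone): re-route around the registered OPEN CONJECTURE Literature.Probability.RandomPlanarGeometry.SAW.HexSAWScalingLimit (DCS Conj. 1, [status: op (planner-rbadge-CriticalPhenomena-SAWMassiveIsi-b208270b-g4-0)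
- 2026-08-16T02:18:12Z · AUTO-CRUX: 1 conjecture-grade item(s) promoted to crux (OneClassOnCriticalCurve) — refuter vetting / tiering apply (operator:999:1362873)
- 2026-08-16T14:03:57Z · rev 4: restated Assembly (stmt-CriticalPhenomena-10351 proved) — route-repair (ground): Assembly stmt-CriticalPhenomena-10351 failed #h21_ground (ground.trivial: intros; aesop) because it was the type of `closes` verbatim — p (planner-rground-CriticalPhenomena-SAWMassiveIsi-b208270b-0)
- 2026-08-26T09:39:29Z · DORMANT — reconciler: no traction for 8.4 d (last activity item-evidence-added at 2026-08-18T00:10:33Z); parked, not closed — `ledger route dormant route-CriticalPhenomen (operator:999:965824)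

sub-problem: SAWScalingLimit · status: dormant · opened planner-plancard-CriticalPhenomena-SAWScaling-7767945d-0 2026-08-15T12:15:47Z · rev 4 · ledger route-CriticalPhenomena-SAWMassiveIsingTilt
GENERATED by the gate from the ledger (D-0016/17). Provers cite these decls: `theorem foo : Summit.CriticalPhenomena.SAWScalingLimit.Theses.SAWMassiveIsingTilt.<Decl> := …` in Summits/CriticalPhenomena/SAWScalingLimit/Theorems/<Name>.lean.
-/

namespace Summit.CriticalPhenomena.SAWScalingLimit.Theses.SAWMassiveIsingTilt

open scoped BigOperators Topology Manifold Classical MeasureTheory ProbabilityTheory Matrix InnerProductSpace ComplexConjugate ContinuousMap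
open Filter Set Function TopologicalSpace MeasureTheory

attribute [summit_statement] _root_.SAWScalingLimit

/-- item stmt-CriticalPhenomena-7684 · target · rank 0 · open · by planner
why it might fail: an intermediate multicritical point on the curve (bath-mediated depletion attraction of range ξ(y) collapsing the walk before y_c), or x_c(y) first-order for y > 0; and it contains DCS Conjecture 1 at y = 0.
sources: DuminilCopinSmirnov2012, Nienhuis1982, DuplantierSaleur1987, LawlerSchrammWerner2004SAW, Literature.Probability.RandomPlanarGeometry.SAW.HexSAWScalingLimit
[target] Conjecture C with the SAW corner pinned (the new half of X; the other half is the shared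
crux LatticeUniversality): there is xc : ℝ → ℝ with xc 0 = hexCriticalFugacity = 1/√(2+√2) such that
for every y ∈ [0, 1/√3), every Dobrushin domain D and hexagonal endpoint approximation, the tilted
interface law 𝔓_{xc(y), y} (weight x^{ℓ(γ)}·Zloop(Ω_δ∖γ; y), normalised) pushed to CurveClass ℂ
converges in law to chordal SLE_{8/3} in D (ConvergesInLawToSLE (8/3)). At y = 0 this is DCS
Conjecture 1 (HexSAWScalingLimit) verbatim. -/
@[route_item "route-CriticalPhenomena-SAWMassiveIsingTilt"]
def OneClassOnCriticalCurve : Prop :=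
  let Zloop : SimpleGraph Literature.Probability.LatticeModels.HexVertex → Set Literature.Probability.LatticeModels.HexVertex → ℝ → ℝ := fun H S y => ∑ᶠ E ∈ {E : Finset (Sym2 Literature.Probability.LatticeModels.HexVertex) | (∀ e ∈ E, e ∈ H.edgeSet ∧ ∀ v ∈ e, v ∈ S) ∧ ∀ v : Literature.Probability.LatticeModels.HexVertex, Even (E.filter (fun e => v ∈ e)).card}, y ^ E.card; let tilt : (Ω : Set ℂ) → (δ : ℝ) → ℝ → ℝ → (a b : Literature.Probability.LatticeModels.HexVertex) → MeasureTheory.Measure (Literature.Probability.RandomPlanarGeometry.SAW.HexDomainSAW Ω δ a b) := fun Ω δ x y a b => MeasureTheory.Measure.sum (fun γ : Literature.Probability.RandomPlanarGeometry.SAW.HexDomainSAW Ω δ a b => ENNReal.ofReal (x ^ γ.vertexCount * Zloop (Literature.Probability.RandomPlanarGeometry.SAW.hexDomainGraph Ω δ) {v | v ∉ γ.walk.support} y) • MeasureTheory.Measure.dirac γ); let tiltLaw : (Ω : Set ℂ) → (δ : ℝ) → ℝ → ℝ → (a b : Literature.Probability.LatticeModels.HexVertex) → MeasureTheory.Measure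 (Literature.Probability.RandomPlanarGeometry.SAW.HexDomainSAW Ω δ a b) := fun Ω δ x y a b => (tilt Ω δ x y a b Set.univ)⁻¹ • tilt Ω δ x y a b; ∃ xc : ℝ → ℝ, xc 0 = Literature.Probability.RandomPlanarGeometry.SAW.hexCriticalFugacity ∧ ∀ y ∈ Set.Ico (0 : ℝ) (Real.sqrt 3)⁻¹, ∀ (D : Literature.Probability.RandomPlanarGeometry.DobrushinDomain) (a b : ℝ → Literature.Probability.LatticeModels.HexVertex), Literature.Probability.RandomPlanarGeometry.SAW.IsEmbEndpointApprox Literature.Probability.LatticeModels.hexGraph Literature.Probability.LatticeModels.hexCenter D a b → Literature.Probability.RandomPlanarGeometry.ConvergesInLawToSLE ((8 : NNReal) / 3) D (fun δ (γ : Literature.Probability.RandomPlanarGeometry.SAW.HexDomainSAW D.carrier δ (a δ) (b δ)) => γ.curve) (fun δ => tiltLaw D.carrier δ (xc y) y (a δ) (b δ))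

/-- item stmt-CriticalPhenomena-7685 · crux · rank 2 · open · by planner
why it might fail: no convergence theorem for thermal near-critical Ising interfaces (massive SLE₃ conjectural); the massless drained bath leaves a ONE-sided restriction-1/2 path (Werner–Wu), so mass+tilt must move the exponent to 5/8; the diagonal limit may not exist or may remember the mass profile.
sources: MakarovSmirnov2010, WernerWu2013, doi:10.1214/ejp.v18-2376, LawlerSchrammWerner2003Restriction, ChelkakIzyurovMahfouf2023, Park2022
[crux] COOL AND PAY ⇒ 8/3 (card N1+N2+N3, diagonalised into one lattice statement; hardest and most
informative): there are m, x : ℝ → ℝ with m(δ) → +∞ and m(δ)·δ → 0 as δ → 0+ (so y(δ) := 1/√3 −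
m(δ)δ ↑ y_c: the Ising bath is cooled by a macroscopically vanishing but microscopically diverging
amount, correlation length 1/m(δ) → 0 in the domain and → ∞ in lattice units) such that for every
Dobrushin domain and hexagonal endpoint approximation the tilted Ising interface laws 𝔓_{x(δ), y(δ)}
converge in law on CurveClass ℂ to chordal SLE_{8/3}. Informally: the infrared limit of the
near-critical family Q_{m,s} (massive SLE₃ ⊗ e^{s𝔏}, 𝔏 the 11/8-dimensional natural length) along
its critical tilt s_c(m) is conformally invariant (covariance + profile insensitivity), satisfies
two-sided restriction (from mass) on simple curves, hence is SLE_{8/3} by LSW03 — read back on the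
lattice along a diagonal. [deps: RestrictionFromMass] [difficulty: open-problem] -/
@[route_item "route-CriticalPhenomena-SAWMassiveIsingTilt", crux]
def MassiveWindowSLE : Prop :=
  let Zloop : SimpleGraph Literature.Probability.LatticeModels.HexVertex → Set Literature.Probability.LatticeModels.HexVertex → ℝ → ℝ := fun H S y => ∑ᶠ E ∈ {E : Finset (Sym2 Literature.Probability.LatticeModels.HexVertex) | (∀ e ∈ E, e ∈ H.edgeSet ∧ ∀ v ∈ e, v ∈ S) ∧ ∀ v : Literature.Probability.LatticeModels.HexVertex, Even (E.filter (fun e => v ∈ e)).card}, y ^ E.card; let tilt : (Ω : Set ℂ) → (δ : ℝ) → ℝ → ℝ → (a b : Literature.Probability.LatticeModels.HexVertex) → MeasureTheory.Measure (Literature.Probability.RandomPlanarGeometry.SAW.HexDomainSAW Ω δ a b) := fun Ω δ x y a b => MeasureTheory.Measure.sum (fun γ : Literature.Probability.RandomPlanarGeometry.SAW.HexDomainSAW Ω δ a b => ENNReal.ofReal (x ^ γ.vertexCount * Zloop (Literature.Probability.RandomPlanarGeometry.SAW.hexDomainGraph Ω δ) {v | v ∉ γ.walk.support} y) • MeasureTheory.Measure.dirac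 γ); let tiltLaw : (Ω : Set ℂ) → (δ : ℝ) → ℝ → ℝ → (a b : Literature.Probability.LatticeModels.HexVertex) → MeasureTheory.Measure (Literature.Probability.RandomPlanarGeometry.SAW.HexDomainSAW Ω δ a b) := fun Ω δ x y a b => (tilt Ω δ x y a b Set.univ)⁻¹ • tilt Ω δ x y a b; ∃ m x : ℝ → ℝ, Filter.Tendsto m (nhdsWithin 0 (Set.Ioi 0)) Filter.atTop ∧ Filter.Tendsto (fun δ => m δ * δ) (nhdsWithin 0 (Set.Ioi 0)) (nhds 0) ∧ ∀ (D : Literature.Probability.RandomPlanarGeometry.DobrushinDomain) (a b : ℝ → Literature.Probability.LatticeModels.HexVertex), Literature.Probability.RandomPlanarGeometry.SAW.IsEmbEndpointApprox Literature.Probability.LatticeModels.hexGraph Literature.Probability.LatticeModels.hexCenter D a b → Literature.Probability.RandomPlanarGeometry.ConvergesInLawToSLE ((8 : NNReal) / 3) D (fun δ (γ : Literature.Probability.RandomPlanarGeometry.SAW.HexDomainSAW D.carrier δ (a δ) (b δ)) => γ.curve) (fun δ => tiltLaw D.carrier δ (x δ) ((Real.sqrt 3)⁻¹ - m δ * δ)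 (a δ) (b δ))

/-- item stmt-CriticalPhenomena-7686 · crux · rank 3 · open · by planner
why it might fail: the bubble-mediated self-interaction is a depletion ATTRACTION of range ξ(y) ↑ ∞; a θ-like multicritical y_θ < y_c (cf. Duplantier–Saleur: a CRITICAL annealed bath on Hex gives κ = 6 at (x,y) = (1,1)) or an x-first-order stretch would break constancy on [0, y_c).
sources: DuplantierSaleur1987, doi:10.1103/PhysRevLett.59.539, DuminilCopinKozmaYadin2014, arXiv:0908.0452, BloteNienhuis1989, Nienhuis1982
[crux] NO TRANSITION ON THE OPEN CRITICAL CURVE (card N4): MassiveWindowSLE →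
OneClassOnCriticalCurve — the SLE_{8/3} limit obtained along one cooled-and-paid path entering the
Ising corner propagates to every fixed 0 ≤ y < y_c along the critical curve x_c(y) and in particular
to the SAW corner (x_c(0), 0) = (1/√(2+√2), 0): the scaling limit of 𝔓_{x_c(y),y} is constant in y
(score decoupling Cov_y(f(γ), ∂_y log Zloop(Ω_δ∖γ; y)) → 0: the y-score is a fugacity
renormalisation plus an irrelevant finite-range remainder), the double limit (δ → 0, y ↑ y_c)
commuting with y ↓ 0. [deps: MassiveWindowSLE, RestrictionFromMass] [difficulty: XL] -/
@[route_item "route-CriticalPhenomena-SAWMassiveIsingTilt", crux]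
def CriticalCurveContinuity : Prop :=
  MassiveWindowSLE → OneClassOnCriticalCurve

/-- item stmt-CriticalPhenomena-0807 · crux · rank 4 · open · by planner
why it might fail: uniform ℤ² SAW is in no Yang–Baxter/integrable family (GlazmanManolescu2019 p.1; barrier NienhuisWeightsExcludeVertexSAW): no transfer tool reaches it; lattice effects persist in limits of boundary SAW ensembles (KennedyLawler2013); the typed difference → 0 needs tightness of both.
sources: GlazmanManolescu2019, arXiv:1109.3091, DuminilCopinSmirnov2012, Literature.Barriers.CriticalPhenomena.NienhuisWeightsExcludeVertexSAW, Literature.Barriers.CriticalPhenomena.not_hasExactVertexRelationZ2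
[crux] r2 (hardest, most informative; informal until defn HexSAWLaw lands): lattice universality of
the chordal critical SAW law — for every Dobrushin domain (Ω; a, b), every square-lattice endpoint
approximation (a_δ, b_δ) (Literature.Probability.RandomPlanarGeometry.SAW.IsEndpointApprox) and
every hexagonal-lattice endpoint approximation (a'_δ, b'_δ), and every bounded continuous f on
CurveClass ℂ: ∫ f∘curve dP^{Z^2}_{x_c(Z^2),δ} − ∫ f∘curve dP^{Hex}_{x_c(Hex),δ} → 0 as δ → 0+
(x_c(Hex) = 1/√(2+√2), Duminil-Copin–Smirnov 2012 Thm 1). Tool: Yang–Baxter track exchange on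
rhombic tilings (Glazman–Manolescu arXiv:1708.00395 §3), which so far controls boundary two-point
functions, not curve laws. -/
@[route_item "route-CriticalPhenomena-SAWMassiveIsingTilt", crux]
def LatticeUniversality : Prop :=
  ∀ (D : Literature.Probability.RandomPlanarGeometry.DobrushinDomain) (a b : ℝ → Literature.Probability.LatticeModels.Site 2) (a' b' : ℝ → Literature.Probability.LatticeModels.HexVertex), Literature.Probability.RandomPlanarGeometry.SAW.IsEndpointApprox D a b → Literature.Probability.RandomPlanarGeometry.SAW.IsEmbEndpointApprox Literature.Probability.LatticeModels.hexGraph Literature.Probability.LatticeModels.hexCenter D a' b' → ∀ f : BoundedContinuousFunction (Literature.Probability.RandomPlanarGeometry.CurveClass ℂ) ℝ, Filter.Tendsto (fun δ => (∫ γ, f γ.curve ∂(Literature.Probability.RandomPlanarGeometry.SAW.law D.carrier δ (a δ) (b δ))) - ∫ γ, f γ.curve ∂(Literature.Probability.RandomPlanarGeometry.SAW.hexSAWLaw D.carrier δ (a' δ) (b' δ))) (nhdsWithin 0 (Set.Ioi 0)) (nhds 0)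

/-- item stmt-CriticalPhenomena-7687 · crux · rank 5 · open · by planner
why it might fail: constants must be uniform over ALL slit subgraphs S ⊆ Ω_δ and blow up as y ↑ y_c; only y inside the Kotecký–Preiss radius (cycles at activity y^|loop|, μ_Hex·y small) is routine — the full range needs ratio mixing of HT Ising on arbitrary subgraphs in free-energy-difference form.
sources: KoteckyPreiss1986, AizenmanBarskyFernandezJSP1987, FriedliVelenik2017, CampaninoIoffeVelenik2003, GriffithsHurstSherman1970, LawlerSchrammWerner2003Restriction
[crux] RESTRICTION EMERGES FROM MASS, on the lattice (card N2(b), the engine of MassiveWindowSLE):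
for every 0 ≤ y < 1/√3 there are C and c > 0 such that for every Dobrushin domain D, mesh δ > 0,
vertex set S ⊆ V := vertices of Ω_δ (H := hexDomainGraph D.carrier δ) and hexagonal SAW γ of Ω_δ
with vertices T ⊆ S: |log( Zloop(H, V∖T; y)·Zloop(H, S; y) / (Zloop(H, S∖T; y)·Zloop(H, V; y)) )| ≤
C Σ_{v ∈ γ} Σ_{w ∈ V∖S} exp(−c·d_Hex(v, w)). In words: the Radon–Nikodym defect between 𝔓_{x,y} in Ω
conditioned on γ ⊂ S and 𝔓_{x,y} in the subdomain S is exp(O(Σ e^{−c·dist})): a massive bath forgets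
the room beyond its correlation length, so two-sided conformal restriction holds asymptotically at
every y < y_c and exactly in the infrared limit. Route to a proof: Zloop(H[S]; y) is the
high-temperature expansion of the Ising model on the subgraph H[S] at tanh β = y < tanh β_c(Hex) =
1/√3; small y by Kotecký–Preiss (polymers = cycles), all y < y_c by Griffiths monotonicity in the
subgraph + ABF sharpness + integration of edge-energy differences along an interpolation of the
couplings on E(V)∖E(S). [difficulty: L] -/
@[route_item "route-CriticalPhenomena-SAWMassiveIsingTilt"]
def RestrictionFromMass : Prop :=
  let Zloop : SimpleGraph Literature.Probability.LatticeModels.HexVertex → Set Literature.Probability.LatticeModels.HexVertex → ℝ → ℝ := fun H S y => ∑ᶠ E ∈ {E : Finset (Sym2 Literature.Probability.LatticeModels.HexVertex) | (∀ e ∈ E, e ∈ H.edgeSet ∧ ∀ v ∈ e, v ∈ S) ∧ ∀ v : Literature.Probability.LatticeModels.HexVertex, Even (E.filter (fun e => v ∈ e)).card}, y ^ E.card; ∀ y ∈ Set.Ico (0 : ℝ) (Real.sqrt 3)⁻¹, ∃ C c : ℝ, 0 < c ∧ ∀ (D : Literature.Probability.RandomPlanarGeometry.DobrushinDomain) (δ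 : ℝ), 0 < δ → ∀ (S : Set Literature.Probability.LatticeModels.HexVertex) (a b : Literature.Probability.LatticeModels.HexVertex) (γ : Literature.Probability.RandomPlanarGeometry.SAW.HexDomainSAW D.carrier δ a b), (∀ v ∈ γ.walk.support, v ∈ S) → S ⊆ Literature.Probability.RandomPlanarGeometry.SAW.embMeshDomain Literature.Probability.LatticeModels.hexGraph Literature.Probability.LatticeModels.hexCenter D.carrier δ → let H := Literature.Probability.RandomPlanarGeometry.SAW.hexDomainGraph D.carrier δ; let V := Literature.Probability.RandomPlanarGeometry.SAW.embMeshDomain Literature.Probability.LatticeModels.hexGraph Literature.Probability.LatticeModels.hexCenter D.carrier δ; let T : Set Literature.Probability.LatticeModels.HexVertex := {v | v ∈ γ.walk.support}; |Real.log ((Zloop H (V \ T) y * Zloop H S y) / (Zloop H (S \ T) y * Zloop H V y))| ≤ C * ∑ v ∈ γ.walk.support.toFinset, ∑ᶠ w ∈ V \ S, Real.exp (-(c * (Literature.Probability.LatticeModels.hexGraph.dist v w : ℝ)))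

/-- item stmt-CriticalPhenomena-9857 · support · rank 9 · closed · proved by Summit.CriticalPhenomena.SAWScalingLimit.Theorems.cornerLaw_proof @ 93199528ccef (prover) · by planner
[support] the y = 0 edge of the tilted family IS the hexagonal SAW law: for every Ω, δ, a, b,
tiltLaw Ω δ x_c(Hex) 0 a b = hexSAWLaw Ω δ a b — Zloop(H, S; 0) = 1 (only E = ∅ survives:
finsum_eq_single), so the tilted weight is x_c^{ℓ(γ)} and the tilted law is embLaw at
hexCriticalFugacity = hexSAWLaw, definitionally. Replaces rev 0's CornerIdentity without naming DCS
Conjecture 1; proof sketch (lemma zloop_zero + unfolding) = refuter evidence on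
stmt-CriticalPhenomena-7688. [difficulty: provable-now] [sources: DuminilCopinSmirnov2012] -/
@[route_item "route-CriticalPhenomena-SAWMassiveIsingTilt", crux]
def CornerLaw : Prop :=
  let Zloop : SimpleGraph Literature.Probability.LatticeModels.HexVertex → Set Literature.Probability.LatticeModels.HexVertex → ℝ → ℝ := fun H S y => ∑ᶠ E ∈ {E : Finset (Sym2 Literature.Probability.LatticeModels.HexVertex) | (∀ e ∈ E, e ∈ H.edgeSet ∧ ∀ v ∈ e, v ∈ S) ∧ ∀ v : Literature.Probability.LatticeModels.HexVertex, Even (E.filter (fun e => v ∈ e)).card}, y ^ E.card; let tilt : (Ω : Set ℂ) → (δ : ℝ) → ℝ → ℝ → (a b : Literature.Probability.LatticeModels.HexVertex) → MeasureTheory.Measure (Literature.Probability.RandomPlanarGeometry.SAW.HexDomainSAW Ω δ a b) := fun Ω δ x y a b => MeasureTheory.Measure.sum (fun γ : Literature.Probability.RandomPlanarGeometry.SAW.HexDomainSAW Ω δ a b => ENNReal.ofReal (x ^ γ.vertexCount * Zloop (Literature.Probability.RandomPlanarGeometry.SAW.hexDomainGraph Ω δ) {v | v ∉ γ.walk.support}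 y) • MeasureTheory.Measure.dirac γ); let tiltLaw : (Ω : Set ℂ) → (δ : ℝ) → ℝ → ℝ → (a b : Literature.Probability.LatticeModels.HexVertex) → MeasureTheory.Measure (Literature.Probability.RandomPlanarGeometry.SAW.HexDomainSAW Ω δ a b) := fun Ω δ x y a b => (tilt Ω δ x y a b Set.univ)⁻¹ • tilt Ω δ x y a b; ∀ (Ω : Set ℂ) (δ : ℝ) (a b : Literature.Probability.LatticeModels.HexVertex), tiltLaw Ω δ Literature.Probability.RandomPlanarGeometry.SAW.hexCriticalFugacity 0 a b = Literature.Probability.RandomPlanarGeometry.SAW.hexSAWLaw Ω δ a b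

-- `CornerLaw` holds: proved by `Summit.CriticalPhenomena.SAWScalingLimit.Theorems.cornerLaw_proof` @ 93199528ccef (its module imports this route file, so no `_holds` link can be stated here).

/-- item stmt-CriticalPhenomena-9864 · support · rank 9 · closed · proved by Summit.CriticalPhenomena.SAWScalingLimit.Theorems.HexEndpointApprox.hexEndpointApproxExists @ 109199b0e098 (prover) · by planner
[support] every Dobrushin domain that admits a δℤ² endpoint approximation admits a hexagonal one:
IsEndpointApprox D a b → ∃ a′ b′ : ℝ → HexVertex, IsEmbEndpointApprox hexGraph hexCenter D a′ b′.
Proof route: for a bounded Jordan domain the bulk connected component of the hexagonal mesh graph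
(the one containing the cells of any fixed compact K ⊂ Ω once δ is small) is the unique largest
component for small δ (every other component lies in the part of Ω not δ-path-connected to K, whose
cell count is o(δ⁻²)), and it accumulates at every boundary point (Ω open and connected: interior
points near D.pt 0, D.pt 1 are joined to K by compact paths at positive distance from ∂Ω); choose
a′_δ, b′_δ in it with δ·hexCenter → the marked points. The discretisation geometry hidden in every
Hex → ℤ² transfer (implicit in the shared glue stmt-CriticalPhenomena-5428); natural Literature
home: a lemma exists_isEmbEndpointApprox in HexSAW.lean. [difficulty: M] [sources:
DuminilCopinSmirnov2012 §4; LawlerSchrammWerner2004SAW §3.4] -/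
@[route_item "route-CriticalPhenomena-SAWMassiveIsingTilt", crux]
def HexEndpointApproxExists : Prop :=
  ∀ (D : Literature.Probability.RandomPlanarGeometry.DobrushinDomain) (a b : ℝ → Literature.Probability.LatticeModels.Site 2), Literature.Probability.RandomPlanarGeometry.SAW.IsEndpointApprox D a b → ∃ a' b' : ℝ → Literature.Probability.LatticeModels.HexVertex, Literature.Probability.RandomPlanarGeometry.SAW.IsEmbEndpointApprox Literature.Probability.LatticeModels.hexGraph Literature.Probability.LatticeModels.hexCenter D a' b'

-- `HexEndpointApproxExists` holds: proved by `Summit.CriticalPhenomena.SAWScalingLimit.Theorems.HexEndpointApprox.hexEndpointApproxExists` @ 109199b0e098 (its module imports this route file, so no `_holds` link can be stated here).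

/-- item stmt-CriticalPhenomena-9865 · support · rank 9 · closed · proved by Summit.CriticalPhenomena.SAWScalingLimit.Theorems.CornerTransfer_proof (prover) · by planner
[support] CornerLaw → HexEndpointApproxExists → OneClassOnCriticalCurve → LatticeUniversality →
SAWScalingLimit — fix a Dobrushin domain D and a δℤ² endpoint approximation (a, b); pick a hexagonal
one (a′, b′) by HexEndpointApproxExists; specialise OneClassOnCriticalCurve at y = 0 ∈ [0, 1/√3),
rewrite xc 0 = hexCriticalFugacity and CornerLaw: ConvergesInLawToSLE (8/3) D for hexSAWLaw, i.e. an
SLE_{8/3} curve Γ with TendstoLaw; for the δℤ² laws take the same Γ, AEMeasurable from the discrete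
σ-algebra (aemeasurable_curve), and for each bounded continuous f write ∫ f dP^{ℤ²} = (∫ f dP^{ℤ²} −
∫ f dP^{Hex}) + ∫ f dP^{Hex} → 0 + ∫ f(Γ) (LatticeUniversality + Tendsto.add). Replaces HexToSquare
in this route (stmt-CriticalPhenomena-5428 stays with its sibling routes). [deps: CornerLaw,
HexEndpointApproxExists, OneClassOnCriticalCurve, LatticeUniversality] [difficulty: provable-now]
[sources: DuminilCopinSmirnov2012; GlazmanManolescu2019] -/
@[route_item "route-CriticalPhenomena-SAWMassiveIsingTilt", crux]
def CornerTransfer : Prop :=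
  CornerLaw → HexEndpointApproxExists → OneClassOnCriticalCurve → LatticeUniversality → SAWScalingLimit

-- `CornerTransfer` holds: proved by `Summit.CriticalPhenomena.SAWScalingLimit.Theorems.CornerTransfer_proof` (its module imports this route file, so no `_holds` link can be stated here).

-- earlier Assembly (stmt-CriticalPhenomena-10351, replaced 2026-08-16T14:03:57Z -> stmt-CriticalPhenomena-15220): proved by Summit.CriticalPhenomena.SAWScalingLimit.Theorems.massiveIsingTilt_assembly_proof — MassiveWindowSLE → CriticalCurveContinuity → CornerLaw → HexEndpointApproxExists → CornerTransfer → LatticeUniversality → SAWScalingLimit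
-- earlier Assembly (stmt-CriticalPhenomena-7689, replaced 2026-08-15T16:12:00Z -> stmt-CriticalPhenomena-10351): retired by None — MassiveWindowSLE → CriticalCurveContinuity → CornerIdentity → HexToSquare → LatticeUniversality → SAWScalingLimit
/-- item stmt-CriticalPhenomena-15220 · assembly · rank 1 · closed · proved by Summit.CriticalPhenomena.SAWScalingLimit.Theorems.massiveIsingTilt_assembly_proof @ 44eec5ab6514 (prover) · by planner
sources: LawlerSchrammWerner2003Restriction, DuminilCopinSmirnov2012, MakarovSmirnov2010
[assembly] MassiveWindowSLE → CriticalCurveContinuity → CornerLaw → HexEndpointApproxExists →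
LatticeUniversality → SAWScalingLimit — the CONTENT-BEARING assembly of the closes chain (rev 4,
ground repair 2026-08-16): the two cruxes of the line (MassiveWindowSLE and CriticalCurveContinuity,
together the target OneClassOnCriticalCurve), the proved corner identity CornerLaw (tiltLaw Ω δ
x_c(Hex) 0 a b = hexSAWLaw Ω δ a b), the discretisation support HexEndpointApproxExists and the
shared transfer crux LatticeUniversality imply SAWScalingLimit. The pure-glue support CornerTransfer
is deliberately NOT an antecedent, so the item carries the corner transfer itself: specialise the
target at y = 0 ∈ [0, 1/√3), rewrite xc 0 = hexCriticalFugacity and CornerLaw to get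
ConvergesInLawToSLE (8/3) for hexSAWLaw along a hexagonal endpoint approximation, keep the same SLE
curve Γ for the δℤ² laws (SAW.aemeasurable_curve) and write ∫ f dP^{ℤ²} = (∫ f dP^{ℤ²} − ∫ f
dP^{Hex}) + ∫ f dP^{Hex} → 0 + 𝔼 f(Γ) (LatticeUniversality, Tendsto.add). PROVABLE NOW in three
lines over the landed theorem: `intro hMW hCC hCL hHE hLU; exact
Summit.CriticalPhenomena.SAWScalingLimit.Theorems.CornerTransfer_proof hCL hHE -/
@[route_item "route-CriticalPhenomena-SAWMassiveIsingTilt"]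
def Assembly : Prop :=
  MassiveWindowSLE → CriticalCurveContinuity → CornerLaw → HexEndpointApproxExists → LatticeUniversality → SAWScalingLimit

-- `Assembly` holds: proved by `Summit.CriticalPhenomena.SAWScalingLimit.Theorems.massiveIsingTilt_assembly_proof` @ 44eec5ab6514 (its module imports this route file, so no `_holds` link can be stated here).

/-! D-0027 §2.1 — DECIDING THEOREM (planner-authored via `route open/edit --closes-file`; by planner-rbadge-CriticalPhenomena-SAWMassiveIsi-b208270b-g4-0 2026-08-15T16:10:56Z):
its hypotheses are this route's items and its conclusion the sub-problem Statement (glue_lint), and it elaborates with this file. -/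

@[closes "route-CriticalPhenomena-SAWMassiveIsingTilt"] theorem closes : MassiveWindowSLE → CriticalCurveContinuity → CornerLaw → HexEndpointApproxExists → CornerTransfer → LatticeUniversality → _root_.SAWScalingLimit :=
  fun h_MassiveWindowSLE h_CriticalCurveContinuity h_CornerLaw h_HexEndpointApproxExists h_CornerTransfer h_LatticeUniversality =>
    h_CornerTransfer h_CornerLaw h_HexEndpointApproxExists (h_CriticalCurveContinuity h_MassiveWindowSLE) h_LatticeUniversality

end Summit.CriticalPhenomena.SAWScalingLimit.Theses.SAWMassiveIsingTilt
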